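import Summits.RiemannHypothesis.RiemannHypothesis.Theorems.WeilGroundStateGroundStatesConvergeToXiStubZeroSideTruncation
import Summits.RiemannHypothesis.RiemannHypothesis.Theorems.WeilGroundStateGroundStatesConvergeToXiMellinByParts
import Summits.RiemannHypothesis.RiemannHypothesis.Theorems.WeilGroundStateGroundStatesConvergeToXiExpClassHarmonic
import Literature.NumberTheory.LFunctions.WeilExplicit
import Literature.NumberTheory.LFunctions.WeilExplicitProofs
import Literature.NumberTheory.LFunctions.ZetaZeroReciprocalSum
import Literature.Analysis.Calculus.SmoothCutoff
import Literature.NumberTheory.LFunctions.LargeValuesFourierDecay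
import Mathlib.Analysis.Calculus.IteratedDeriv.Lemmas
import HarnessLib

/-!
# `WeilGroundState.GroundStatesConvergeToXi` — Weil-harmonicity extends from tests to the strong class
(crux item stmt-RiemannHypothesis-1527, route route-RiemannHypothesis-WeilGroundState; line `Sketch`,
stub `stub_harmonic_extension` (K3); `--supports`)

Let `v : ℝ → ℂ` be a.e.-strongly measurable with `∫ ‖v(t)‖ e^{b₁|t|} dt < ∞` (`b₁ > 1/2`) and
WEIL-HARMONIC AGAINST TESTS: `W(v ⋆ g̃) = 0` for every Weil test function `g`.  Then
`W(v ⋆ h̃) = 0` for every `h` of the STRONG EXPONENTIAL WEIL CLASS (smooth, all derivatives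
`O(e^{-b₀|t|})`, `1/2 < b₀ ≤ b₁`), GIVEN (as hypotheses) the class explicit formula (EF') and the
strong-class pairing (K1).

Proof: the plateau truncations `h_R = h · χ_R` are tests, so `W(v ⋆ h̃_R) = 0`; both `v ⋆ h̃` and
`v ⋆ h̃_R` lie in the class (K1), so by (EF') `W(v ⋆ h̃) = Σ'_ρ m(ρ) (v ⋆ h̃)^(ρ)` and
`0 = Σ'_ρ m(ρ) (v ⋆ h̃_R)^(ρ)`; termwise
`(v ⋆ h̃)^(ρ) − (v ⋆ h̃_R)^(ρ) = v̂(ρ) conj(ĥ − ĥ_R)(1 − conj ρ)` with `‖v̂(ρ)‖ ≤ ∫‖v‖e^{|t|/2}` and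
`‖(ĥ − ĥ_R)(1 − conj ρ)‖ ≤ τ(R)/(1 + γ²)`, `τ(R) → 0` (`zsTrunc_tail_control`), whence
`‖W(v ⋆ h̃)‖ ≤ (∫‖v‖e^{|t|/2}) τ(R) Σ_ρ m(ρ)/(1 + γ²) → 0`.

No new definitions; no named fact is used.
-/

noncomputable section

set_option linter.dupNamespace false

open scoped Topology Real ComplexConjugate
open Filter Set MeasureTheory Complex

namespace Summit.RiemannHypothesis.RiemannHypothesis.Theorems.GroundStatesConvergeToXi

open Literature.NumberTheory.LFunctions

/-! ## Compactly supported smooth functions lie in the strong class -/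

/-- A continuous compactly supported `g` satisfies `‖g(t)‖ ≤ C e^{-b₀|t|}` for some `C`
(`b₀ ≥ 0`): `g` is bounded and vanishes off a ball. [folklore] -/
theorem hExt_bound_of_hasCompactSupport {g : ℝ → ℂ} (hc : Continuous g)
    (hs : HasCompactSupport g) {b₀ : ℝ} (hb : 0 ≤ b₀) :
    ∃ C : ℝ, ∀ t : ℝ, ‖g t‖ ≤ C * Real.exp (-(b₀ * |t|)) := by
  obtain ⟨B, hB⟩ := hc.bounded_above_of_compact_support hs
  obtain ⟨M, hM⟩ := hs.isCompact.isBounded.subset_closedBall 0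
  have hB0 : 0 ≤ B := (norm_nonneg _).trans (hB 0)
  refine ⟨B * Real.exp (b₀ * M), fun t => ?_⟩
  by_cases ht : g t = 0
  · rw [ht, norm_zero]; positivity
  · have htM : |t| ≤ M := by
      have h1 : t ∈ Metric.closedBall (0 : ℝ) M := hM (subset_tsupport _ ht)
      rwa [Metric.mem_closedBall, Real.dist_eq, sub_zero] at h1
    have hexp : (1 : ℝ) ≤ Real.exp (b₀ * M) * Real.exp (-(b₀ * |t|)) := by
      rw [← Real.exp_add]
      exact Real.one_le_exp (by nlinarith [mul_le_mul_of_nonneg_left htM hb])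
    calc ‖g t‖ ≤ B := hB t
      _ ≤ B * (Real.exp (b₀ * M) * Real.exp (-(b₀ * |t|))) := le_mul_of_one_le_right hB0 hexp
      _ = B * Real.exp (b₀ * M) * Real.exp (-(b₀ * |t|)) := by ring

/-- A Weil test function lies in the strong exponential class of any rate `b₀ ≥ 0` (its iterated
derivatives are continuous of compact support, `GuthMaynardFourier.hasCompactSupport_iteratedDeriv`).
[folklore] -/
theorem hExt_strong_of_isWeilTest {g : ℝ → ℂ} (hg : IsWeilTest g) {b₀ : ℝ} (hb : 0 ≤ b₀)
    (k : ℕ) : ∃ C : ℝ, ∀ t : ℝ, ‖iteratedDeriv k g t‖ ≤ C * Real.exp (-(b₀ * |t|)) :=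
  hExt_bound_of_hasCompactSupport (hg.1.continuous_iteratedDeriv k (by exact_mod_cast le_top))
    (GuthMaynardFourier.hasCompactSupport_iteratedDeriv hg.2 k) hb

/-! ## From the all-orders envelope to the `k ≤ 2` envelope -/

/-- The `k ≤ 2` bounds with a single constant, extracted from the all-orders envelope
(`iteratedDeriv_zero`, `iteratedDeriv_one`, `iteratedDeriv_succ`). [folklore] -/
theorem hExt_deriv_bounds_of_all {F : ℝ → ℂ} {b₀ : ℝ}
    (hbd : ∀ k : ℕ, ∃ C : ℝ, ∀ t : ℝ, ‖iteratedDeriv k F t‖ ≤ C * Real.exp (-(b₀ * |t|))) :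
    ∃ C : ℝ, (∀ t, ‖F t‖ ≤ C * Real.exp (-(b₀ * |t|))) ∧
      (∀ t, ‖deriv F t‖ ≤ C * Real.exp (-(b₀ * |t|))) ∧
      (∀ t, ‖deriv (deriv F) t‖ ≤ C * Real.exp (-(b₀ * |t|))) := by
  obtain ⟨C₀, h₀⟩ := hbd 0
  obtain ⟨C₁, h₁⟩ := hbd 1
  obtain ⟨C₂, h₂⟩ := hbd 2
  refine ⟨max C₀ (max C₁ C₂), fun t => ?_, fun t => ?_, fun t => ?_⟩
  · have h := h₀ t
    rw [iteratedDeriv_zero] at h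
    exact h.trans (mul_le_mul_of_nonneg_right (le_max_left _ _) (Real.exp_pos _).le)
  · have h := h₁ t
    rw [iteratedDeriv_one] at h
    exact h.trans (mul_le_mul_of_nonneg_right ((le_max_left _ _).trans (le_max_right _ _))
      (Real.exp_pos _).le)
  · have h := h₂ t
    rw [iteratedDeriv_succ, iteratedDeriv_one] at h
    exact h.trans (mul_le_mul_of_nonneg_right ((le_max_right _ _).trans (le_max_right _ _))
      (Real.exp_pos _).le)

/-! ## The transform of a weighted-`L¹` function is bounded in the closed strip -/

/-- `‖v̂(s)‖ ≤ ∫ ‖v‖ e^{|t|/2}` for `0 ≤ Re s ≤ 1`, the right side being finite when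
`∫ ‖v‖ e^{b₁|t|} < ∞` with `b₁ > 1/2`. [folklore] -/
theorem hExt_norm_weilMellin_le {v : ℝ → ℂ} {b₁ : ℝ} (hv : AEStronglyMeasurable v volume)
    (hb₁ : 1 / 2 < b₁) (hint : Integrable (fun t : ℝ => ‖v t‖ * Real.exp (b₁ * |t|))) {s : ℂ}
    (hs0 : 0 ≤ s.re) (hs1 : s.re ≤ 1) :
    ‖weilMellin v s‖ ≤ ∫ t : ℝ, ‖v t‖ * Real.exp (|t| / 2) := by
  have hint' : Integrable (fun t : ℝ => ‖v t‖ * Real.exp (|t| / 2)) := by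
    refine hint.mono' (hv.norm.mul (Continuous.aestronglyMeasurable (by fun_prop)))
      (ae_of_all _ fun t => ?_)
    rw [Real.norm_eq_abs, abs_mul, abs_norm, abs_of_pos (Real.exp_pos _)]
    exact mul_le_mul_of_nonneg_left (Real.exp_le_exp.2 (by nlinarith [abs_nonneg t]))
      (norm_nonneg _)
  exact norm_weilMellin_le_integral_norm_mul_exp_half hs0 hs1 hint'

/-! ## The stub -/

/-- **Stub K3 — `harmonic_extension` (RH-free; takes (EF') and K1 as hypotheses).**  If `v` with
`∫‖v‖e^{b₁|t|} < ∞` (`b₁ > 1/2`) is Weil-harmonic against tests, `W(v ⋆ g̃) = 0` for every test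
`g`, then `W(v ⋆ h̃) = 0` for every `h` of the strong class with rate `b₀ ∈ (1/2, b₁]`: truncate
`h_R = h · cutoff R` (tests), write both functionals as zero-side sums by (EF'), and pass to the
limit `R → ∞` by dominated convergence over the zeros (`‖ĥ − ĥ_R‖ ≤ τ(R)/(1+Im²)`,
`zsTrunc_tail_control`; `‖v̂(ρ)‖ ≤ ∫‖v‖e^{|t|/2}`; `Σ m/(1+γ²) < ∞`). [folklore] -/
theorem stub_harmonic_extension :
    (∀ (f : ℝ → ℂ) (C b₀ : ℝ), ContDiff ℝ (⊤ : ℕ∞) f → 1 / 2 < b₀ →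
      (∀ t, ‖f t‖ ≤ C * Real.exp (-(b₀ * |t|))) →
      (∀ t, ‖deriv f t‖ ≤ C * Real.exp (-(b₀ * |t|))) →
      (∀ t, ‖deriv (deriv f) t‖ ≤ C * Real.exp (-(b₀ * |t|))) →
      Summable (fun ρ : ZetaZeros.riemannZetaNontrivialZeros =>
          ‖(riemannZetaZeroOrder (ρ : ℂ) : ℂ) * weilMellin f ρ‖) ∧
      ∑' ρ : ZetaZeros.riemannZetaNontrivialZeros,
          (riemannZetaZeroOrder (ρ : ℂ) : ℂ) * weilMellin f ρ = weilFunctional f) →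
    (∀ (v h : ℝ → ℂ) (b₁ b₀ : ℝ), AEStronglyMeasurable v volume → 1 / 2 < b₁ →
      Integrable (fun t : ℝ => ‖v t‖ * Real.exp (b₁ * |t|)) →
      ContDiff ℝ (⊤ : ℕ∞) h → 1 / 2 < b₀ → b₀ ≤ b₁ →
      (∀ k : ℕ, ∃ C : ℝ, ∀ t : ℝ, ‖iteratedDeriv k h t‖ ≤ C * Real.exp (-(b₀ * |t|))) →
      ContDiff ℝ (⊤ : ℕ∞) (weilConv v (weilReflect h)) ∧
      (∀ k : ℕ, ∃ C : ℝ, ∀ t : ℝ,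
        ‖iteratedDeriv k (weilConv v (weilReflect h)) t‖ ≤ C * Real.exp (-(b₀ * |t|))) ∧
      ∀ s : ℂ, 0 ≤ s.re → s.re ≤ 1 →
        weilMellin (weilConv v (weilReflect h)) s =
          weilMellin v s * (starRingEnd ℂ) (weilMellin h (1 - (starRingEnd ℂ) s))) →
    ∀ (v : ℝ → ℂ) (b₁ : ℝ), AEStronglyMeasurable v volume → 1 / 2 < b₁ →
      Integrable (fun t : ℝ => ‖v t‖ * Real.exp (b₁ * |t|)) →
      (∀ g : ℝ → ℂ, IsWeilTest g → weilFunctional (weilConv v (weilReflect g)) = 0) →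
      ∀ (h : ℝ → ℂ) (b₀ : ℝ), ContDiff ℝ (⊤ : ℕ∞) h → 1 / 2 < b₀ → b₀ ≤ b₁ →
        (∀ k : ℕ, ∃ C : ℝ, ∀ t : ℝ, ‖iteratedDeriv k h t‖ ≤ C * Real.exp (-(b₀ * |t|))) →
        weilFunctional (weilConv v (weilReflect h)) = 0 := by
  intro hEF hK1 v b₁ hv hb₁ hint hharm h b₀ hh hb₀ hle hbd
  have hb₀' : 0 ≤ b₀ := by linarith
  -- tail control for `h` (needs the `k ≤ 2` envelope of `h`)
  obtain ⟨Ch, hh0, hh1, hh2⟩ := hExt_deriv_bounds_of_all hbd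
  have hdh : Differentiable ℝ h := (contDiff_infty_iff_deriv.mp hh).1
  have hh' : ContDiff ℝ (⊤ : ℕ∞) (deriv h) := (contDiff_infty_iff_deriv.mp hh).2
  have hdh' : Differentiable ℝ (deriv h) := (contDiff_infty_iff_deriv.mp hh').1
  have hc'' : Continuous (deriv (deriv h)) := (contDiff_infty_iff_deriv.mp hh').2.continuous
  obtain ⟨τ, hτ, hτb⟩ := zsTrunc_tail_control hb₀ (fun t => (hdh t).hasDerivAt)
    (fun t => (hdh' t).hasDerivAt) hc'' hh0 hh1 hh2
  -- the truncations `h_R = h χ_R` are tests, hence in the strong class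
  have htest : ∀ R : ℝ,
      IsWeilTest (fun t : ℝ => h t * ((Literature.Analysis.Calculus.cutoff R t : ℝ) : ℂ)) :=
    fun R => isWeilTest_mul_cutoff hh R
  -- K1 for `h` and for the truncations; (EF') for both convolutions
  obtain ⟨hFs, hFb, hFm⟩ := hK1 v h b₁ b₀ hv hb₁ hint hh hb₀ hle hbd
  obtain ⟨CF, hF0, hF1, hF2⟩ := hExt_deriv_bounds_of_all hFb
  obtain ⟨hFsum, hFeq⟩ := hEF _ CF b₀ hFs hb₀ hF0 hF1 hF2
  have hR : ∀ R : ℝ,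
      (∀ s : ℂ, 0 ≤ s.re → s.re ≤ 1 →
        weilMellin (weilConv v (weilReflect
          (fun t : ℝ => h t * ((Literature.Analysis.Calculus.cutoff R t : ℝ) : ℂ)))) s =
          weilMellin v s * conj (weilMellin
            (fun t : ℝ => h t * ((Literature.Analysis.Calculus.cutoff R t : ℝ) : ℂ)) (1 - conj s))) ∧
      Summable (fun ρ : ZetaZeros.riemannZetaNontrivialZeros =>
        ‖(riemannZetaZeroOrder (ρ : ℂ) : ℂ) * weilMellin (weilConv v (weilReflect
          (fun t : ℝ => h t * ((Literature.Analysis.Calculus.cutoff R t : ℝ) : ℂ)))) ρ‖) ∧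
      ∑' ρ : ZetaZeros.riemannZetaNontrivialZeros,
        (riemannZetaZeroOrder (ρ : ℂ) : ℂ) * weilMellin (weilConv v (weilReflect
          (fun t : ℝ => h t * ((Literature.Analysis.Calculus.cutoff R t : ℝ) : ℂ)))) ρ = 0 := by
    intro R
    obtain ⟨hs, hb, hm⟩ := hK1 v _ b₁ b₀ hv hb₁ hint (htest R).1 hb₀ hle
      (fun k => hExt_strong_of_isWeilTest (htest R) hb₀' k)
    obtain ⟨C, h0, h1, h2⟩ := hExt_deriv_bounds_of_all hb
    obtain ⟨hsum, heq⟩ := hEF _ C b₀ hs hb₀ h0 h1 h2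
    exact ⟨hm, hsum, heq.trans (hharm _ (htest R))⟩
  -- the constants `V = ∫‖v‖e^{|t|/2}` and `Z = Σ_ρ m(ρ)/(1+γ²)`
  set V : ℝ := ∫ t : ℝ, ‖v t‖ * Real.exp (|t| / 2) with hVdef
  have hV0 : 0 ≤ V := integral_nonneg fun t => by positivity
  have hV : ∀ s : ℂ, 0 ≤ s.re → s.re ≤ 1 → ‖weilMellin v s‖ ≤ V := fun s hs0 hs1 =>
    hExt_norm_weilMellin_le hv hb₁ hint hs0 hs1
  set Z : ℝ := ∑' ρ : ZetaZeros.riemannZetaNontrivialZeros,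
    (riemannZetaZeroOrder (ρ : ℂ) : ℝ) / (1 + (ρ : ℂ).im ^ 2) with hZdef
  -- `‖W(v ⋆ h̃)‖ ≤ V τ(R) Z` for every `R`
  have hbound : ∀ R : ℝ, ‖weilFunctional (weilConv v (weilReflect h))‖ ≤ V * τ R * Z := by
    intro R
    obtain ⟨hRm, hRsum, hReq⟩ := hR R
    have hA : ∀ s : ℂ, 0 ≤ s.re → s.re ≤ 1 →
        ‖weilMellin (weilConv v (weilReflect h)) s - weilMellin (weilConv v (weilReflect
          (fun t : ℝ => h t * ((Literature.Analysis.Calculus.cutoff R t : ℝ) : ℂ)))) s‖ ≤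
          V * τ R / (1 + s.im ^ 2) := by
      intro s hs0 hs1
      have h1s0 : 0 ≤ (1 - conj s).re := by
        simp only [sub_re, one_re, conj_re]; linarith
      have h1s1 : (1 - conj s).re ≤ 1 := by
        simp only [sub_re, one_re, conj_re]; linarith
      have him : (1 - conj s).im = s.im := by simp
      have hτs := hτb R (1 - conj s) h1s0 h1s1
      rw [him] at hτs
      rw [hFm s hs0 hs1, hRm s hs0 hs1, ← mul_sub, ← map_sub, norm_mul, Complex.norm_conj,
        mul_div_assoc]
      exact mul_le_mul (hV s hs0 hs1) hτs (norm_nonneg _) hV0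
    obtain ⟨hDn, hDle⟩ := zsTrunc_summable_of_le
      (a := fun s => weilMellin (weilConv v (weilReflect h)) s - weilMellin (weilConv v
        (weilReflect (fun t : ℝ => h t * ((Literature.Analysis.Calculus.cutoff R t : ℝ) : ℂ)))) s)
      hA
    have hdiff : ∑' ρ : ZetaZeros.riemannZetaNontrivialZeros,
        (riemannZetaZeroOrder (ρ : ℂ) : ℂ) *
          (weilMellin (weilConv v (weilReflect h)) ρ - weilMellin (weilConv v (weilReflect
            (fun t : ℝ => h t * ((Literature.Analysis.Calculus.cutoff R t : ℝ) : ℂ)))) ρ) =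
        weilFunctional (weilConv v (weilReflect h)) := by
      have hsub := (hFsum.of_norm).tsum_sub (hRsum.of_norm)
      rw [hFeq, hReq, sub_zero] at hsub
      rw [← hsub]
      exact tsum_congr fun ρ => by ring
    rw [← hdiff]
    exact (norm_tsum_le_tsum_norm hDn).trans hDle
  -- let `R → ∞`
  have hlim : Tendsto (fun R : ℝ => V * τ R * Z) atTop (𝓝 0) := by
    have hl := (hτ.const_mul V).mul_const Z
    rwa [mul_zero, zero_mul] at hl
  exact norm_le_zero_iff.1 (ge_of_tendsto' hlim hbound)

end Summit.RiemannHypothesis.RiemannHypothesis.Theorems.GroundStatesConvergeToXi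

end
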